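import Mathlib.Algebra.Group.InjSurj
import Literature.AlgebraicGeometry.Frobenioids.RlfStructureWeak
import Literature.AnabelianGeometry.EtaleTheta.TemperedFrobenioid
import Literature.AnabelianGeometry.EtaleTheta.FrdIVocabularyWeak

/-!
# [EtTh] Def 3.6 (i): `Φ₀^ℝ(Y)` is integral (cancellative) at the WEAK [FrdI] vocabulary — the binder `hInt`
# DISCHARGED for every realified datum over `treeMonoidVocabWeak`

S. Mochizuki, *The étale theta function …*, Publ. RIMS **45** (2009) [MochizukiEtTh2009], Def. 3.6 (i), PDF p.76
("`Φ₀^ℝ := Φ₀^rlf`"); *The geometry of Frobenioids I* [MochizukiFrdI2008], Def. 2.4 (i)(c), kurims p.47–48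
(`M^rlf ⊆ ∏_𝔭 M^rlf_𝔭`, a submonoid of a product of copies of `ℝ_{≥0}`, hence integral).

WEAK-VOCABULARY TWIN of abc-iut-w5-d135's `Discharge/Sec3PhiRIntegralTreeVocab.lean`: there `T :
RealifiedDivisorMonoids treeMonoidVocab`; here `T : RealifiedDivisorMonoids treeMonoidVocabWeak` (abc-iut-L2-t3's weak
vocabulary: `IsRealification := IsRealificationViaWeak`, an isomorphism `Φ₀^ℝ(Y) ≃* Φ₀(Y)^rlf` onto the WEAK
realification of the weakly perf-factorial `Φ₀(Y)` — the reading valid at `Ÿ`, `Z_∞`, cell findings F-L2d2-1 and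
F-L2d2-2), and the weak `M^rlf` is cancellative (`IsPerfFactorialWeak.Rlf.isCancelMul`, `RlfStructureWeak.lean`, seat
abc-iut-L2-d2).  So the binder `hInt : ∀ Y, IsCancelMul (T.ΦR.obj Y)` of the Def. 3.6 (ii)(b) / Thm. 3.7 (ii) /
Cor. 3.8 consumers can be dropped over the weak vocabulary as well.  Theorems only; seat abc-iut-L2-d2 (gen 3; port),
original proofs abc-iut-w5-d135.  HONEST FRAMING: refereed pre-IUT material; nothing here bears on [IUTchIII] Cor. 3.12.
-/

namespace Literature.AnabelianGeometry.EtaleTheta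

open CategoryTheory Opposite Literature.AlgebraicGeometry.Frobenioids Function

universe u₀ v₀ u v w

/-- Cancellativity transports along an injective multiplicative map into a cancellative monoid (Mathlib
`Function.Injective.isCancelMul`). [folklore] -/
private theorem isCancelMul_of_injective_mulHom_weak {M N : Type*} [Mul M] [Mul N] [IsCancelMul N]
    (φ : M →ₙ* N) (hφ : Injective φ) : IsCancelMul M :=
  hφ.isCancelMul φ (map_mul φ)

namespace RealifiedDivisorMonoids

/-- **`Φ₀^ℝ(Y)` is integral for EVERY Def 3.6 (i) datum over the weak vocabulary** (`hInt` discharged):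
`T.isRealification Y` exhibits `Φ₀^ℝ(Y) ≃* Φ₀(Y)^rlf` (weak realification), which is cancellative.
[cite: MochizukiEtTh2009, Def 3.6 p.76] -/
theorem isCancelMul_ΦR_weak {D₀ : Type u₀} [Category.{v₀} D₀]
    (T : RealifiedDivisorMonoids (D₀ := D₀) treeMonoidVocabWeak.{w}) (Y : D₀ᵒᵖ) : IsCancelMul (T.ΦR.obj Y) := by
  obtain ⟨h, e, -⟩ := T.isRealification Y
  haveI : IsCancelMul h.Rlf := IsPerfFactorialWeak.Rlf.isCancelMul h
  exact isCancelMul_of_injective_mulHom_weak (e : T.ΦR.obj Y →ₙ* h.Rlf) e.injective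

/-- `hInt` in the binder shape of the Def 3.6 (ii)(b) / Thm 3.7 (ii) consumers, for every `T` over the weak
vocabulary. [cite: MochizukiEtTh2009, Def 3.6 p.76] -/
theorem hInt_treeMonoidVocabWeak {D₀ : Type u₀} [Category.{v₀} D₀]
    (T : RealifiedDivisorMonoids (D₀ := D₀) treeMonoidVocabWeak.{w}) : ∀ Y : D₀ᵒᵖ, IsCancelMul (T.ΦR.obj Y) :=
  fun Y => T.isCancelMul_ΦR_weak Y

end RealifiedDivisorMonoids

namespace TemperedFrobenioid

/-- **`Φ^{ℝ-log}(A) = Φ₀^ℝ(Y_A)` is integral** for every tempered Frobenioid over the weak vocabulary.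
[cite: MochizukiEtTh2009, Def 3.6 p.76] -/
theorem isCancelMul_ΦRlog_weak {D₀ : Type u₀} [Category.{v₀} D₀]
    {T : RealifiedDivisorMonoids (D₀ := D₀) treeMonoidVocabWeak.{w}} {D : Type u} [Category.{v} D]
    {VD : FrdICatStub.{u, v, w} D} (C : TemperedFrobenioid T D VD) (A : Dᵒᵖ) : IsCancelMul (C.ΦRlog.obj A) :=
  T.isCancelMul_ΦR_weak (C.baseOp A)

/-- Hence the divisor monoid `Φ(A) ⊆ Φ^{ℝ-log}(A)` of a tempered Frobenioid over the weak vocabulary is integral,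
as a submonoid of an integral monoid. [cite: MochizukiEtTh2009, Def 3.6 p.77] -/
theorem isCancelMul_divisorMonoid_weak' {D₀ : Type u₀} [Category.{v₀} D₀]
    {T : RealifiedDivisorMonoids (D₀ := D₀) treeMonoidVocabWeak.{w}} {D : Type u} [Category.{v} D]
    {VD : FrdICatStub.{u, v, w} D} (C : TemperedFrobenioid T D VD) (A : Dᵒᵖ) :
    IsCancelMul (C.divisorMonoid.obj A) := by
  haveI := C.isCancelMul_ΦRlog_weak A
  exact isCancelMul_of_injective_mulHom_weak
    ((C.Φ.carrier A).subtype : C.Φ.carrier A →ₙ* C.ΦRlog.obj A) Subtype.val_injective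

end TemperedFrobenioid

end Literature.AnabelianGeometry.EtaleTheta
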